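import Literature.NumberTheory.PAdicHodge.BdRPlusFormalLogModFil
import Literature.NumberTheory.PAdicHodge.AinfEvalPtTruncation
import HarnessLib

/-!
# `log_W(ι(a ⊕_W b)) ≡ log_W(ι a) + log_W(ι b) (mod Fil^k B_dR⁺)` on `Ŵ((p, ξ)𝔸_inf)`

Topic `Literature/NumberTheory/PAdicHodge`; namespace `Literature.NumberTheory.PAdicHodge.GaloisContinuity`. THEOREMS ONLY (no definition, no instance, no
named fact, no `sorry`). Assembly of `BdRPlusFormalLogModFil` (`IsFormalLogModFil W k x L`: `L = log_W(ι x) mod Fil^k`, additive GIVEN the `(p,ξ)`-adic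
approximation of the sum point) and `AinfEvalPtTruncation` (that approximation for the tree's chord–tangent sum `AinfTop.addW`): for points `a, b` of `Ŵ(𝔫)`
(K1's `nilTheta`) with coordinates in `(p, ξ)`,

* ★★ `IsFormalLogModFil.addW` — values `L`, `L'` of `log_W(ι a)`, `log_W(ι b)` modulo `Fil^k` add to a value of `log_W(ι(a ⊕_W b))`:
  Fontaine's `p`-adic formal logarithm `Ŵ((p,ξ)𝔸_inf) → B_dR⁺/Fil^k` is a HOMOMORPHISM for the chord–tangent law — the elliptic twin of `IsLogModFil.add`
  (`BdRPlusLogLatticeMul`) and the `p`-adic layer of Fontaine's integrating element `log_W(ι[ũ])` (K1, `AinfWeierstrassKummerIntegral`).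

Floor (H4) step (3) of `Summits/…/Cruxes/StarredOptimalManinUnitFiveSeven/Lines/kato-lever-K3-B2-road.md` (memo `…-K3-H4-log.md` §3b; crux K★
`stmt-BirchSwinnertonDyer-22226`). Infrastructure only; BSD / K★ are not proved by any of this.

## References
* J. H. Silverman, *The Arithmetic of Elliptic Curves* (2009), IV.5.2. [SilvermanAEC2009]
* J.-M. Fontaine, *Formes différentielles et modules de Tate…*, Invent. Math. 65 (1982), §5. [Fontaine1982FormesDifferentielles]
-/

noncomputable section

namespace Literature.NumberTheory.PAdicHodge

namespace GaloisContinuity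

open ValuativeRel Field Ideal WittVector
open Literature.NumberTheory.GaloisRepresentations Literature.NumberTheory.GaloisRepresentations.IsNonarchimedeanLocalField
open Literature.NumberTheory.GaloisRepresentations.LubinTate
open MvPowerSeries (truncTotal)

variable {F : Type} [Field F] [ValuativeRel F] [TopologicalSpace F] [IsNonarchimedeanLocalField F]
  [CharZero F] {p : ℕ} [Fact p.Prime] [Fact (¬ IsUnit (p : integerC F))]
  [IsAdicComplete (Ideal.span {(p : integerC F)}) (integerC F)]
  {hθ : Function.Surjective (fontaineTheta (integerC F) p)}

/-- ★★ **`log_W` is additive on `Ŵ((p, ξ)𝔸_inf)` modulo `Fil^k`.** For points `a, b` of `Ŵ(𝔫)` with coordinates in `(p, ξ)` and values `L`, `L'` of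
`log_W(ι a)`, `log_W(ι b)` modulo `Fil^k B_dR⁺`, `L + L'` is a value of `log_W(ι(a ⊕_W b))` for the tree's chord–tangent sum `AinfTop.addW`.
[cite: SilvermanAEC2009, IV.5.2] [cite: Fontaine1982FormesDifferentielles, §5] -/
theorem IsFormalLogModFil.addW (W : WeierstrassCurve ℤ) {k : ℕ} {a b : (AinfTop.nilTheta F p hθ).toIdeal}
    (ha : (AinfTop.of F p).symm (a : AinfTop F p) ∈ Ideal.span {(p : Ainf (p := p) F), xi})
    (hb : (AinfTop.of F p).symm (b : AinfTop F p) ∈ Ideal.span {(p : Ainf (p := p) F), xi})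
    {L L' : BDeRhamPlus (integerC F) p} (hL : IsFormalLogModFil W k ((AinfTop.of F p).symm (a : AinfTop F p)) L)
    (hL' : IsFormalLogModFil W k ((AinfTop.of F p).symm (b : AinfTop F p)) L') :
    IsFormalLogModFil W k ((AinfTop.of F p).symm ((AinfTop.addW W a b : (AinfTop.nilTheta F p hθ).toIdeal) : AinfTop F p)) (L + L') := by
  refine IsFormalLogModFil.add ha hb (fun D => ?_) hL hL'
  have h := AinfTop.coe_addW_sub_aeval_truncTotal_mem (hθ := hθ) W a b ha hb D
  have e : (fun i => (((![a, b] : Fin 2 → (AinfTop.nilTheta F p hθ).toIdeal) i : (AinfTop.nilTheta F p hθ).toIdeal) : AinfTop F p)) =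
      ![(AinfTop.of F p).symm (a : AinfTop F p), (AinfTop.of F p).symm (b : AinfTop F p)] := by
    funext i; fin_cases i <;> rfl
  rw [e] at h
  exact h

end GaloisContinuity

end Literature.NumberTheory.PAdicHodge

end
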